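import Summits.PneNP.PneNP.Theorems.BruckRyserSosSosBlindPlanes

/-! F3 witness (fwd-rung PneNP/01): the rung's graded family `ThreshRung N` specialises to the PROVED floor
at the floor's own threshold function — `ThreshRung (fun d => Classical.choose (sosBlindPlanes_proof d))` —
and the floor is literally `∃ N, ThreshRung N`; no sorry. -/

set_option linter.dupNamespace false
noncomputable section
namespace Summit.PneNP.PneNP.Cruxes.SosBlindPlanesLinear.EffectiveThreshold
open Literature.Computability.MetaComplexity
open Summit.PneNP.PneNP.Theses.BruckRyserSos
open Summit.PneNP.PneNP.Theorems.SosBlindPlanes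

/-- Degree-`d` SOS blindness of the projective-plane system of order `n` (board `v = n² + n + 1`,
variable `x_(p,B) = X (p v + B)`): the common conclusion block of `SosBlindPlanes`,
`SosBlindPlanesLinear` and `sosBlindPlanes_allOrders`. -/
def BlindAt (d n : ℕ) : Prop :=
  ∃ E : MvPolynomial ℕ ℝ →ₗ[ℝ] ℝ, IsPseudoexpectation d E ∧
    (∀ w : ℕ, SatisfiesIdentity d E (boolAxiom w)) ∧
    (∀ p < n ^ 2 + n + 1, SatisfiesIdentity d E
      ((∑ B ∈ Finset.range (n ^ 2 + n + 1), MvPolynomial.X (p * (n ^ 2 + n + 1) + B)) -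
        MvPolynomial.C ((n + 1 : ℕ) : ℝ))) ∧
    (∀ B < n ^ 2 + n + 1, SatisfiesIdentity d E
      ((∑ p ∈ Finset.range (n ^ 2 + n + 1), MvPolynomial.X (p * (n ^ 2 + n + 1) + B)) -
        MvPolynomial.C ((n + 1 : ℕ) : ℝ))) ∧
    (∀ p < n ^ 2 + n + 1, ∀ p' < n ^ 2 + n + 1, p ≠ p' → SatisfiesIdentity d E
      ((∑ B ∈ Finset.range (n ^ 2 + n + 1), MvPolynomial.X (p * (n ^ 2 + n + 1) + B) *
        MvPolynomial.X (p' * (n ^ 2 + n + 1) + B)) - MvPolynomial.C (1 : ℝ))) ∧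
    (∀ B < n ^ 2 + n + 1, ∀ B' < n ^ 2 + n + 1, B ≠ B' → SatisfiesIdentity d E
      ((∑ p ∈ Finset.range (n ^ 2 + n + 1), MvPolynomial.X (p * (n ^ 2 + n + 1) + B) *
        MvPolynomial.X (p * (n ^ 2 + n + 1) + B')) - MvPolynomial.C (1 : ℝ)))

/-- GRADED FAMILY I (threshold functions): for every degree `d`, every Bruck–Ryser–Chowla excluded
order `n ≥ N d` is degree-`d` blind. -/
def ThreshRung (N : ℕ → ℕ) : Prop :=
  ∀ d : ℕ, ∀ n ≥ N d, (n % 4 = 1 ∨ n % 4 = 2) → (¬ ∃ a b : ℕ, a ^ 2 + b ^ 2 = n) → BlindAt d n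

/-- GRADED FAMILY II (degree profiles): eventually every BRC-excluded order `n` is degree-`f n`
blind. -/
def DegreeRung (f : ℕ → ℕ) : Prop :=
  ∃ N : ℕ, ∀ n ≥ N, (n % 4 = 1 ∨ n % 4 = 2) → (¬ ∃ a b : ℕ, a ^ 2 + b ^ 2 = n) → BlindAt (f n) n

/-- **THE RUNG.** Effective `SosBlindPlanes` with a threshold singly exponential in `d log d`
(the scale of the floor's own trace board `Nsos d ≤ (d+2)^{2(d+2)}`): there is `C` such that for
every `d` and every BRC-excluded `n ≥ (d+2)^{C(d+2)}` the plane system of order `n` has a degree-`d`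
pseudoexpectation. Equivalently: degree-`⌊c log n / log log n⌋` SOS does not refute `¬PP(n)`. -/
def EffectiveSosBlindPlanes : Prop :=
  ∃ C : ℕ, ThreshRung (fun d => (d + 2) ^ (C * (d + 2)))


/-- `Rung ⟨floor parameters⟩`: the floor's threshold function is a member of family I. -/
example : ThreshRung (fun d => Classical.choose (sosBlindPlanes_proof d)) :=
  fun d => Classical.choose_spec (sosBlindPlanes_proof d)

/-- The floor is `∃ N, ThreshRung N`, by `simpa` from the floor decl. -/
theorem EffectiveSosBlindPlanes_special : ∃ N, ThreshRung N := by
  have h := sosBlindPlanes_proof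
  choose N hN using h
  exact ⟨N, hN⟩

/-- The floor is also the constant-profile member of family II, literally. -/
example : ∀ d, DegreeRung (fun _ => d) := fun d => sosBlindPlanes_proof d

/-- And the rung sits above it: Rung → floor. -/
example : EffectiveSosBlindPlanes → SosBlindPlanes := by
  rintro ⟨C, hC⟩ d
  exact ⟨(d + 2) ^ (C * (d + 2)), hC d⟩

end Summit.PneNP.PneNP.Cruxes.SosBlindPlanesLinear.EffectiveThreshold
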